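import Literature.Probability.Percolation.QuadCrossingDualSeparatorArm
import HarnessLib

/-!
# The dual wall package: exit set, wall and region of a first-visit dual crossing

Topic `Probability/Percolation`; chart-level proofs file towards the named fact
`SchrammSmirnov2011_lemma_6_1` (`QuadCrossingContinuity.lean`; O. Schramm, S. Smirnov, *On the
scaling limits of planar percolation*, Ann. Probab. 39 (2011), arXiv:1101.5820, proof of Lemma 6.1,
cases (2)–(3)).

`Charts.mem_annulusOpenCrossingOff_of_dual` (`QuadCrossingDualSeparatorArm.lean`) builds, inside its
proof, the barrier data of a low dual crossing: the chart preimage of the crossing, the strip exit set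
at its landing point, the wall `W = γ ∪ E`, and the inclusion of the bottom open cluster in the region
below `W`.  The two-sided (cut-free) dual argument needs the same package twice (for the quad and its
flip), so it is factored here as `Charts.exists_dualWall`; the proof is the one of steps 3–6 of
`Charts.mem_annulusOpenCrossingOff_of_dual`.  Everything is proved.

## References

* O. Schramm, S. Smirnov, Ann. Probab. 39 (2011) 1768–1814, arXiv:1101.5820, proof of Lemma 6.1.
  [SchrammSmirnov2011]
-/

noncomputable section

open Set Metric Filter Function
open _root_.Topology
open scoped unitInterval
open Literature.Probability.LatticeModels
open Literature.Topology.PlaneTopology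

namespace Literature.Probability.Percolation

namespace SSContinuity

namespace Frame

variable (Φ : Frame) {D : Set ℂ} {Q Q' : QuadCrossing.Quad D} {ω : BondConfig (Site 2)}

variable {Φ} in
/-- **The dual wall package.**  For a first-visit dual crossing `γ` of `[Q']` landing at
`y = Q'(1, θ)` (off the open edges), in the standard frame of `Q'` and for a pair `(Q, Q')`
satisfying condition (2) at scale `ρ < d₀(Q)` with `∂₂Q'` `K`-chord–arc: the strip exit set `E ∋ y`
at `y` with its junction `α₀` and all its bookkeeping (`Charts.exists_exitSet_strip_at`), the wall
`W = γ ∪ E` (compact, connected, in `[Q]`, joining `∂₀Q` to `∂₂Q`, whose drawn points lie in `E`), and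
the inclusion of the bottom open cluster of `[Q']` in the region of `[Q]` below `W`
(`Charts.image_subset_below_of_mem_belowSet`).  Factored out of
`Charts.mem_annulusOpenCrossingOff_of_dual` for the two-sided argument.
[cite: SchrammSmirnov2011, proof of Lemma 6.1, cases (2)–(3)] -/
theorem Charts.exists_dualWall (hΦ : Φ.Charts Q') (hb : Φ.b = 1)
    (hc : Φ.c = -1) (hd : Φ.d = 1) (hG : ∀ t : I, Φ.G ⟨1, 2 * (t : ℝ) - 1⟩ = Q' (1, t))
    (hcar : Q'.carrier ⊆ Q.carrier) (h0 : Q'.side 0 = Q.side 0) (h1 : Q'.side 1 ⊆ Q.side 1)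
    (h3 : Q'.side 3 ⊆ Q.side 3) {ρ : ℝ} (hρ : 0 < ρ) (hρ0 : ρ < Q.sideDist 0)
    (hjoin : ∀ x ∈ Q'.side 2, Q.ShortJoin ρ x (Q.side 2))
    (htame' : ∀ p : Site 2 × Site 2, (zdGraph 2).Adj p.1 p.2 →
      IsPreconnected (Q'.piece Φ.δ p))
    {K : ℝ} (hK : 1 ≤ K)
    (harc : ∀ s t : I, dist (Q' (1, s)) (Q' (1, t)) ≤ ρ → ∀ u : I,
      ((s : ℝ) ≤ u ∧ (u : ℝ) ≤ t ∨ (t : ℝ) ≤ u ∧ (u : ℝ) ≤ s) → dist (Q' (1, u)) (Q' (1, s)) ≤ K * ρ)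
    {γ : ℝ → ℂ} (hγc : ContinuousOn γ (Icc 0 1)) (hγQ : MapsTo γ (Icc 0 1) Q'.carrier)
    (hγO : ∀ t ∈ Icc (0 : ℝ) 1, γ t ∉ openEdgeUnion Φ.δ ω) (hγ0side : γ 0 ∈ Q'.side 0)
    {θn : I} (hθn : γ 1 = Q' (1, θn)) (hfirst : ∀ t ∈ Ico (0 : ℝ) 1, γ t ∉ Q'.side 2) :
    ∃ (y₂ : ℂ) (α₀ : Path (Φ.G (⟨Φ.b, 2 * (θn : ℝ) - 1⟩ : ℂ)) y₂) (E : Set ℂ) (m M : ℝ),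
      Φ.G (⟨Φ.b, 2 * (θn : ℝ) - 1⟩ : ℂ) = Q' (1, θn) ∧
      (2 * (θn : ℝ) - 1) ∈ Icc Φ.c Φ.d ∧
      IsCompact E ∧ IsPreconnected E ∧ E ⊆ Q.carrier ∧ Q' (1, θn) ∈ E ∧ (E ∩ Q.side 2).Nonempty ∧
      (∀ e ∈ E, ∃ p : Path (Φ.G (⟨Φ.b, 2 * (θn : ℝ) - 1⟩ : ℂ)) e, range p ⊆ Q.carrier ∧
        ∀ s, dist (p s) (Φ.G (⟨Φ.b, 2 * (θn : ℝ) - 1⟩ : ℂ)) ≤ K * ρ) ∧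
      Φ.G '' {u | u ∈ Φ.rect ∧ u.re = Φ.b ∧ u.im ∈ Icc m (2 * (θn : ℝ) - 1)} ⊆ E ∧
      (∀ u ∈ Φ.rect, u.re = Φ.b → Φ.G u ∈ E → m ≤ u.im) ∧ E ∩ Q'.side 0 = ∅ ∧
      E ∩ Q'.carrier ⊆ Q'.side 2 ∧ (2 * (θn : ℝ) - 1) ≤ M ∧
      ((⟨Φ.b, M⟩ : ℂ) ∈ Φ.rect ∧ dist (Φ.G ⟨Φ.b, M⟩) (Φ.G (⟨Φ.b, 2 * (θn : ℝ) - 1⟩ : ℂ)) ≤ ρ) ∧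
      (∀ u ∈ Φ.rect, u.re = Φ.b → Φ.G u ∈ E → u.im ≤ M) ∧
      (∀ e ∈ E, e ∈ Φ.G '' {u | u ∈ Φ.rect ∧ u.re = Φ.b} ∨
        ∃ s t : I, (s : ℝ) ≤ t ∧ α₀ t = e ∧ α₀ s ∈ Q'.side 2 ∧
          ∀ u : I, (s : ℝ) ≤ u → (u : ℝ) ≤ t → α₀ u ∈ E) ∧
      (∀ e ∈ E, dist e (Q' (1, θn)) ≤ K * ρ) ∧
      IsCompact (γ '' Icc 0 1 ∪ E) ∧ IsPreconnected (γ '' Icc 0 1 ∪ E) ∧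
      γ '' Icc 0 1 ∪ E ⊆ Q.carrier ∧ ((γ '' Icc 0 1 ∪ E) ∩ Q.side 0).Nonempty ∧
      ((γ '' Icc 0 1 ∪ E) ∩ Q.side 2).Nonempty ∧
      (∀ z ∈ γ '' Icc 0 1 ∪ E, z ∈ openEdgeUnion Φ.δ ω → z ∈ E) ∧
      Q'.bottomCluster Φ.δ ω ⊆ {z | z ∈ Q.carrier ∧ ∀ t ∈ Q.side 3, ∀ π : Path z t,
        range π ⊆ Q.carrier → (range π ∩ (γ '' Icc 0 1 ∪ E)).Nonempty} := by
  have hδ : 0 < Φ.δ := Φ.hδ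
  set y : ℂ := Q' (1, θn) with hydef
  have hy : y = γ 1 := hθn.symm
  have hγ12 : γ 1 ∈ Q'.side 2 := by rw [hθn]; exact ⟨(1, θn), rfl, rfl⟩
  set d : Set ℂ := Q'.bottomCluster Φ.δ ω with hd_def
  -- Step 3: chart data of the barrier `Γ = G⁻¹(γ)`
  set h : ℝ := 2 * (θn : ℝ) - 1 with hh
  have hhI : h ∈ Icc Φ.c Φ.d := by
    rw [hc, hd, hh]; constructor <;> linarith [θn.2.1, θn.2.2]
  set yh : ℂ := ⟨Φ.b, h⟩ with hyh
  have hGy : Φ.G yh = y := by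
    rw [hydef, ← hG θn, hyh]
    congr 1
    apply Complex.ext <;> simp [hb, hh]
  have hpreim : ∀ {w : ℂ}, w ∈ Q'.carrier → Φ.G.symm w ∈ Φ.rect := by
    intro w hw
    rw [hΦ.carrier] at hw
    obtain ⟨u, hu, rfl⟩ := hw
    rwa [Φ.G.symm_apply_apply]
  set Γ : Set ℂ := Φ.G.symm '' (γ '' Icc 0 1) with hΓ
  have hGΓ : Φ.G '' Γ = γ '' Icc 0 1 := by
    rw [hΓ, ← image_comp]
    simp only [Function.comp_def, Homeomorph.apply_symm_apply, image_id']
  have hγimc : IsCompact (γ '' Icc 0 1) := isCompact_Icc.image_of_continuousOn hγc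
  have hΓc : IsCompact Γ := hγimc.image Φ.G.symm.continuous
  have hΓpc : IsPreconnected Γ :=
    (isPreconnected_Icc.image _ hγc).image _ Φ.G.symm.continuous.continuousOn
  have hΓr : Γ ⊆ Φ.rect := by
    rintro _ ⟨z, ⟨t, ht, rfl⟩, rfl⟩
    exact hpreim (hγQ ht)
  have hΓa : ∃ z ∈ Γ, z.re = Φ.a := by
    have h0' := hγ0side
    rw [hΦ.side0] at h0'
    obtain ⟨u, ⟨hur, hure⟩, hue⟩ := h0'
    refine ⟨u, ⟨γ 0, ⟨0, left_mem_Icc.2 zero_le_one, rfl⟩, ?_⟩, hure⟩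
    rw [← hue, Φ.G.symm_apply_apply]
  have hyhΓ : yh ∈ Γ := ⟨y, ⟨1, right_mem_Icc.2 zero_le_one, hy.symm⟩, by
    rw [← hGy, Φ.G.symm_apply_apply]⟩
  have hΓb : ∃ z ∈ Γ, z.re = Φ.b := ⟨yh, hyhΓ, rfl⟩
  have hΓtop : ∀ z ∈ Γ, z.re = Φ.b → z.im ≤ h := by
    rintro z ⟨_, ⟨t, ht, rfl⟩, rfl⟩ hzre
    have hzrect : Φ.G.symm (γ t) ∈ Φ.rect := hpreim (hγQ ht)
    have h2 : γ t ∈ Q'.side 2 := by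
      rw [hΦ.side2]
      exact ⟨Φ.G.symm (γ t), ⟨hzrect, hzre⟩, Φ.G.apply_symm_apply _⟩
    have ht1 : t = 1 := by
      by_contra hne
      exact hfirst t ⟨ht.1, lt_of_le_of_ne ht.2 hne⟩ h2
    subst ht1
    have : Φ.G.symm (γ 1) = yh := by rw [← hy, ← hGy, Φ.G.symm_apply_apply]
    rw [this]
  have hΓO : ∀ z ∈ Γ, Φ.G z ∉ openEdgeUnion Φ.δ ω := by
    rintro _ ⟨_, ⟨t, ht, rfl⟩, rfl⟩
    rw [Φ.G.apply_symm_apply]; exact hγO t ht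
  -- Step 4: the exit set at `y`
  have hy2' : y ∈ Q'.side 2 := by rw [hy]; exact hγ12
  obtain ⟨y₂, hy₂, α, hαQ, hαdiam⟩ := hjoin y hy2'
  have hαx : ∀ s, dist (α s) y ≤ ρ := fun s =>
    (dist_le_diam_of_mem (isCompact_range α.continuous).isBounded ⟨s, rfl⟩ ⟨0, α.source⟩).trans hαdiam
  have hα0 : ∀ s, α s ∉ Q'.side 0 := fun s hs => by
    rw [h0] at hs
    have := QuadCrossing.Quad.sideDist_le hs hy₂ (QuadCrossing.Quad.tailPath α s)
      ((QuadCrossing.Quad.range_tailPath α s).trans hαQ)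
    have hle : Metric.diam (range (QuadCrossing.Quad.tailPath α s)) ≤ ρ :=
      (diam_mono (QuadCrossing.Quad.range_tailPath α s) (isCompact_range α.continuous).isBounded).trans
        hαdiam
    linarith
  set α' : Path (Φ.G yh) y₂ := α.cast hGy rfl with hα'
  have hα'coe : ∀ s, α' s = α s := fun s => by rw [hα', Path.cast_coe]
  obtain ⟨E, m, M, hEc, hEpc, hEQ, hxE, hE2, hEjoin, hAE, hEm, hE0, hE6, hTM, hMd, hmd, hEM, hEanch⟩ :=
    hΦ.exists_exitSet_strip_at hb hc hd hG hhI hρ.le hK harc hcar h0 h1 h3 hy₂ α'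
      (by rintro _ ⟨s, rfl⟩; rw [hα'coe]; exact hαQ ⟨s, rfl⟩)
      (fun s => by rw [hα'coe, hGy]; exact hαx s) (fun s => by rw [hα'coe]; exact hα0 s)
  have hEy : ∀ e ∈ E, dist e y ≤ K * ρ := fun e he => by
    obtain ⟨p, -, hp⟩ := hEjoin e he
    have h1' : dist (p 1) (Φ.G yh) ≤ K * ρ := hp 1
    rw [p.target, hGy] at h1'
    exact h1'
  have hxE' : y ∈ E := by rw [← hGy]; exact hxE
  -- Step 5: the wall and the region below it
  set W : Set ℂ := Φ.G '' Γ ∪ E with hW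
  set Mreg : Set ℂ := {z | z ∈ Q.carrier ∧ ∀ t ∈ Q.side 3, ∀ π : Path z t,
      range π ⊆ Q.carrier → (range π ∩ W).Nonempty} with hMreg
  have hLc : IsCompact (Φ.G '' Γ) := by rw [hGΓ]; exact hγimc
  have hWc : IsCompact W := hLc.union hEc
  have hWcl : IsClosed W := hWc.isClosed
  have hyL : y ∈ Φ.G '' Γ := by rw [hGΓ]; exact ⟨1, right_mem_Icc.2 zero_le_one, hy.symm⟩
  have hWpc : IsPreconnected W := by
    rw [hW]
    refine IsPreconnected.union y hyL hxE' ?_ hEpc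
    rw [hGΓ]; exact isPreconnected_Icc.image _ hγc
  have hWQ : W ⊆ Q.carrier := by
    refine union_subset ?_ hEQ
    rw [hGΓ]; rintro _ ⟨t, ht, rfl⟩; exact hcar (hγQ ht)
  have hW0 : (W ∩ Q.side 0).Nonempty :=
    ⟨γ 0, Or.inl (by rw [hGΓ]; exact ⟨0, left_mem_Icc.2 zero_le_one, rfl⟩), h0 ▸ hγ0side⟩
  have hW2 : (W ∩ Q.side 2).Nonempty := hE2.mono (inter_subset_inter_left _ subset_union_right)
  have hside1M := QuadCrossing.Quad.side_one_subset_below hWc hWpc hWQ hW0 hW2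
  have hWO : ∀ z ∈ W, z ∈ openEdgeUnion Φ.δ ω → z ∈ E := by
    rintro z (⟨u, hu, rfl⟩ | hzE) hzO
    · exact absurd hzO (hΓO u hu)
    · exact hzE
  -- Step 6: the bottom cluster is below the wall
  have hdM : d ⊆ Mreg := by
    intro p hp
    obtain ⟨q₀, hq₀, hpq₀⟩ := mem_iUnion₂.1 hp
    obtain ⟨U, hUd, hUpc, ⟨bpt, hbU, hb1⟩, hq₀U⟩ :=
      QuadCrossing.Quad.exists_isPreconnected_of_reach htame' hq₀
    have hUO : U ⊆ openEdgeUnion Φ.δ ω := fun z hz => (QuadCrossing.Quad.bottomCluster_subset (hUd hz)).1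
    have hUQ' : U ⊆ Q'.carrier := fun z hz => (QuadCrossing.Quad.bottomCluster_subset (hUd hz)).2
    have hKc : IsCompact (closure U) :=
      Q'.isCompact_carrier.of_isClosed_subset isClosed_closure
        (Q'.isCompact_carrier.isClosed.closure_subset_iff.2 hUQ')
    have hKconn : IsConnected (closure U) := ⟨⟨bpt, subset_closure hbU⟩, hUpc.closure⟩
    have hKO : closure U ⊆ openEdgeUnion Φ.δ ω :=
      (isClosed_openEdgeUnion hδ ω).closure_subset_iff.2 hUO
    have hKQ' : closure U ⊆ Q'.carrier := Q'.isCompact_carrier.isClosed.closure_subset_iff.2 hUQ'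
    have hJ := joinedIn_inter_openEdgeUnion_of_isConnected hδ hKc hKconn hKO hKQ'
      (subset_closure hbU) (subset_closure (hq₀U hpq₀))
    set π₀ : Path bpt p := hJ.somePath with hπ₀
    have hπ₀mem : ∀ t, π₀ t ∈ Q'.carrier ∩ openEdgeUnion Φ.δ ω := hJ.somePath_mem
    -- in the chart: the base point is on the bottom side, off `Γ`, hence below `Γ`
    set bh : ℂ := Φ.G.symm bpt with hbh
    have hbhrect : bh ∈ Φ.rect := hpreim (hπ₀mem 0 |>.1 |> fun h => by simpa [π₀.source] using h)
    have hb1' := hb1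
    rw [hΦ.side1] at hb1'
    obtain ⟨u, ⟨hur, huim⟩, hue⟩ := hb1'
    have hbhu : bh = u := by rw [hbh, ← hue, Φ.G.symm_apply_apply]
    have hbhΓ : bh ∉ Γ := fun hmem => hΓO bh hmem (by
      rw [hbh, Φ.G.apply_symm_apply]; exact hUO hbU)
    have hbhbelow : bh ∈ Φ.belowSet Γ :=
      Φ.mem_belowSet_of_im_eq_c hΓr hbhrect (by rw [hbhu]; exact huim) hbhΓ
    -- the chart image of the open chain joins `bh` to `G⁻¹ p` off `Γ`
    set ph : ℂ := Φ.G.symm p with hph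
    have hJ' : JoinedIn (Φ.extRect \ Γ) bh ph := by
      refine ⟨(π₀.map Φ.G.symm.continuous).cast (by rw [hbh]) (by rw [hph]), fun t => ?_⟩
      rw [Path.cast_coe, Path.map_coe, Function.comp_apply]
      refine ⟨Φ.rect_subset_extRect (hpreim (hπ₀mem t).1), fun hmem => ?_⟩
      exact hΓO _ hmem (by rw [Φ.G.apply_symm_apply]; exact (hπ₀mem t).2)
    have hphbelow : ph ∈ Φ.belowSet Γ := Φ.mem_belowSet_of_joinedIn hbhbelow hJ'
    have hphrect : ph ∈ Φ.rect := hpreim (hUQ' (hq₀U hpq₀))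
    have := hΦ.image_subset_below_of_mem_belowSet hcar h0 h1 hΓc hΓpc hΓr hΓa hΓb hΓtop hEc hEQ
      hWpc hE2 hAE hEm hE0 hphbelow hphrect
    rwa [hph, Φ.G.apply_symm_apply] at this
  -- assemble the package
  have hWcγ : IsCompact (γ '' Icc 0 1 ∪ E) := by rw [← hGΓ]; exact hWc
  have hWpcγ : IsPreconnected (γ '' Icc 0 1 ∪ E) := by rw [← hGΓ]; exact hWpc
  have hWQγ : γ '' Icc 0 1 ∪ E ⊆ Q.carrier := by rw [← hGΓ]; exact hWQ
  have hW0γ : ((γ '' Icc 0 1 ∪ E) ∩ Q.side 0).Nonempty := by rw [← hGΓ]; exact hW0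
  have hW2γ : ((γ '' Icc 0 1 ∪ E) ∩ Q.side 2).Nonempty := by rw [← hGΓ]; exact hW2
  have hWOγ : ∀ z ∈ γ '' Icc 0 1 ∪ E, z ∈ openEdgeUnion Φ.δ ω → z ∈ E := by rw [← hGΓ]; exact hWO
  have hdMγ : d ⊆ {z | z ∈ Q.carrier ∧ ∀ t ∈ Q.side 3, ∀ π : Path z t,
      range π ⊆ Q.carrier → (range π ∩ (γ '' Icc 0 1 ∪ E)).Nonempty} := by
    rw [← hGΓ]; exact hdM
  refine ⟨y₂, α', E, m, M, hGy, hhI, hEc, hEpc, hEQ, hxE', hE2, hEjoin, hAE, hEm, hE0, hE6, hTM,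
    hMd, hEM, hEanch, hEy, hWcγ, hWpcγ, hWQγ, hW0γ, hW2γ, hWOγ, hdMγ⟩

end Frame

end SSContinuity

end Literature.Probability.Percolation
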